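import Summits.CriticalPhenomena.PercolationContinuityZ3.Theorems.PercNearOneGluingNoHeavyLowerTailFrontierDecRowsEdgeInduction
import HarnessLib

/-!
# Edge-interpolation SCHEMA for reverse-Harris rows `κ·P(F)·P(E) ≤ P(F ∩ E)` of bond percolation (percolation-level form)

Support file for the Sahi programme (`--supports stmt-CriticalPhenomena-4575`, prover prim-nh-lead-4575 lead gen 126).  No definitions,
no named facts, no sorries; standard axioms.  Companion of `…IncStarEdgeInterpolation` (pure real algebra, p376557; private copies of its three lemmas are inlined here because that olean was not yet built on the farm) and of the lane's
`EdgeInduction.sahiE3_nonneg_of_edgeBernstein` (the same induction on the number of fractional pairs, for Sahi's cubic).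

For ARBITRARY events `F, E ⊆ BondConfig (Fin n)`, a weight `w`, a pair `e` with `p = w e`, and `P₀ = P_{w[e↦0]}`, `P₁ = P_{w[e↦1]}`, the one-bond
decomposition `P_w(S) = (1−p)P₀(S) + pP₁(S)` (tree: `stub_oneBondDecomp_k15`) makes `P_w(F)`, `P_w(E)`, `P_w(F∩E)` affine in `p`, so the three
criteria of `…IncStarEdgeInterpolation` transport the row from `w[e↦0]`, `w[e↦1]` to `w`:
* `revHarris_of_pair_product`  (form 1): `(P₁F − P₀F)(P₁E − P₀E) ≥ 0`;
* `revHarris_of_pair_condF`    (form 2): `P₀F, P₁F > 0` and `(P₁(F∩E)·P₀F − P₀(F∩E)·P₁F)(P₁F − P₀F) ≥ 0`;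
* `revHarris_of_pair_condE`    (form 3): `P₀E, P₁E > 0` and `(P₁(F∩E)·P₀E − P₀(F∩E)·P₁E)(P₁E − P₀E) ≥ 0`.
`revHarris_of_goodPairs` is the induction schema: if `0 ≤ κ ≤ 1` and at every weight with a fractional pair EITHER the row already holds (this is
where base cases enter — e.g. for TCB'/P3 the configurations in which `s` and `a` are surely connected, settled by the lane's (C½)) OR some
fractional pair satisfies one of the three criteria, then the row holds at every weight (at 0/1-valued weights `P_w` is a point mass, tree:
`real_eq_ite_of_zeroOne`, and the row is `κ·1·1 ≤ 1` or `0 ≤ ·`).  Paper-level use (memo prim-sahi/FROM-prim-nh-lead-4575-g126-EDGE-INTERPOLATION.md):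
with `F = F₁ = {s↔a} ∩ {s↮b}`, `E = E₁ = {c↔s} ∪ {c↔b}` this is CONJECTURE E* ⟹ TCB'_{2/3}.
-/

noncomputable section

namespace Summit.CriticalPhenomena.PercolationContinuityZ3.Theorems

namespace IncStar

open MeasureTheory Literature.Probability.Percolation Literature.Probability.LatticeModels EdgeInduction
open scoped Classical

variable {n : ℕ}

/-! ### Private copies of the three algebraic interpolation lemmas (public versions: `…IncStarEdgeInterpolation`, p376557;
that module's olean was not yet built on the farm when this file was checked, hence the private duplicates). -/

/-- Private copy of `IncStar.interp_product` (form 1 algebra). [this work] -/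
private theorem algProduct (κ r N0 N1 F0 F1 E0 E1 : ℝ) (hκ : 0 ≤ κ) (hr0 : 0 ≤ r) (hr1 : r ≤ 1)
    (h0 : κ * F0 * E0 ≤ N0) (h1 : κ * F1 * E1 ≤ N1) (hmono : 0 ≤ (F1 - F0) * (E1 - E0)) :
    κ * ((1 - r) * F0 + r * F1) * ((1 - r) * E0 + r * E1) ≤ (1 - r) * N0 + r * N1 := by
  have hid : ((1 - r) * N0 + r * N1) - κ * ((1 - r) * F0 + r * F1) * ((1 - r) * E0 + r * E1)
      = (1 - r) * (N0 - κ * F0 * E0) + r * (N1 - κ * F1 * E1) + κ * (r * (1 - r)) * ((F1 - F0) * (E1 - E0)) := by ring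
  have h1r : 0 ≤ 1 - r := by linarith
  have t1 : 0 ≤ (1 - r) * (N0 - κ * F0 * E0) := mul_nonneg h1r (by linarith)
  have t2 : 0 ≤ r * (N1 - κ * F1 * E1) := mul_nonneg hr0 (by linarith)
  have t3 : 0 ≤ κ * (r * (1 - r)) * ((F1 - F0) * (E1 - E0)) :=
    mul_nonneg (mul_nonneg hκ (mul_nonneg hr0 h1r)) hmono
  linarith

/-- Private copy of `IncStar.interp_condF` (form 2 algebra). [this work] -/
private theorem algCondF (κ r N0 N1 F0 F1 E0 E1 : ℝ) (hr0 : 0 ≤ r) (hr1 : r ≤ 1)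
    (hF0 : 0 < F0) (hF1 : 0 < F1)
    (h0 : κ * F0 * E0 ≤ N0) (h1 : κ * F1 * E1 ≤ N1) (hW : 0 ≤ (N1 * F0 - N0 * F1) * (F1 - F0)) :
    κ * ((1 - r) * F0 + r * F1) * ((1 - r) * E0 + r * E1) ≤ (1 - r) * N0 + r * N1 := by
  have h1r : 0 ≤ 1 - r := by linarith
  have hFr : 0 < (1 - r) * F0 + r * F1 := by
    rcases lt_or_ge r 1 with hr | hr
    · have : 0 < (1 - r) * F0 := mul_pos (by linarith) hF0
      have : 0 ≤ r * F1 := mul_nonneg hr0 (le_of_lt hF1)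
      linarith
    · have hr' : r = 1 := le_antisymm hr1 hr
      subst hr'; simp; exact hF1
  have e0 : κ * E0 * (F0 * F1) ≤ N0 * F1 := by nlinarith
  have e1 : κ * E1 * (F0 * F1) ≤ N1 * F0 := by nlinarith
  have hid : ((1 - r) * N0 + r * N1) * F0 * F1 - ((1 - r) * F0 + r * F1) * ((1 - r) * N0 * F1 + r * N1 * F0)
      = (r * (1 - r)) * ((F1 - F0) * (N1 * F0 - N0 * F1)) := by ring
  have key : κ * ((1 - r) * E0 + r * E1) * (F0 * F1) ≤ (1 - r) * N0 * F1 + r * N1 * F0 := by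
    have := add_le_add (mul_le_mul_of_nonneg_left e0 h1r) (mul_le_mul_of_nonneg_left e1 hr0)
    nlinarith
  have hW' : 0 ≤ (r * (1 - r)) * ((F1 - F0) * (N1 * F0 - N0 * F1)) := by
    have : 0 ≤ (F1 - F0) * (N1 * F0 - N0 * F1) := by nlinarith
    exact mul_nonneg (mul_nonneg hr0 h1r) this
  have step : ((1 - r) * F0 + r * F1) * (κ * ((1 - r) * E0 + r * E1) * (F0 * F1))
      ≤ ((1 - r) * N0 + r * N1) * F0 * F1 := by
    have := mul_le_mul_of_nonneg_left key (le_of_lt hFr)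
    nlinarith
  have hF01 : 0 < F0 * F1 := mul_pos hF0 hF1
  nlinarith

/-- Private copy of `IncStar.interp_condE` (form 3 algebra). [this work] -/
private theorem algCondE (κ r N0 N1 F0 F1 E0 E1 : ℝ) (hr0 : 0 ≤ r) (hr1 : r ≤ 1)
    (hE0 : 0 < E0) (hE1 : 0 < E1)
    (h0 : κ * F0 * E0 ≤ N0) (h1 : κ * F1 * E1 ≤ N1) (hW : 0 ≤ (N1 * E0 - N0 * E1) * (E1 - E0)) :
    κ * ((1 - r) * F0 + r * F1) * ((1 - r) * E0 + r * E1) ≤ (1 - r) * N0 + r * N1 := by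
  have h := algCondF κ r N0 N1 E0 E1 F0 F1 hr0 hr1 hE0 hE1
    (by linarith [mul_comm F0 E0]) (by linarith [mul_comm F1 E1]) hW
  have hcomm : κ * ((1 - r) * E0 + r * E1) * ((1 - r) * F0 + r * F1)
      = κ * ((1 - r) * F0 + r * F1) * ((1 - r) * E0 + r * E1) := by ring
  linarith [hcomm]

/-- **Form 1 at the percolation level.**  For arbitrary events `F, E`, `κ ≥ 0`, a weight `w` and a pair `e`: if the row
`κ·P(F)·P(E) ≤ P(F∩E)` holds under `w[e↦0]` and `w[e↦1]` and `(P₁F − P₀F)(P₁E − P₀E) ≥ 0`, it holds under `w`. [this work] -/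
theorem revHarris_of_pair_product (κ : ℝ) (hκ : 0 ≤ κ) (F E : Set (BondConfig (Fin n)))
    (w : Sym2 (Fin n) → unitInterval) (e : Sym2 (Fin n))
    (h0 : κ * (prodBernoulli (Function.update w e 0)).real F * (prodBernoulli (Function.update w e 0)).real E
        ≤ (prodBernoulli (Function.update w e 0)).real (F ∩ E))
    (h1 : κ * (prodBernoulli (Function.update w e 1)).real F * (prodBernoulli (Function.update w e 1)).real E
        ≤ (prodBernoulli (Function.update w e 1)).real (F ∩ E))
    (hmono : 0 ≤ ((prodBernoulli (Function.update w e 1)).real F - (prodBernoulli (Function.update w e 0)).real F) *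
        ((prodBernoulli (Function.update w e 1)).real E - (prodBernoulli (Function.update w e 0)).real E)) :
    κ * (prodBernoulli w).real F * (prodBernoulli w).real E ≤ (prodBernoulli w).real (F ∩ E) := by
  rw [stub_oneBondDecomp_k15 n w e F, stub_oneBondDecomp_k15 n w e E, stub_oneBondDecomp_k15 n w e (F ∩ E)]
  exact algProduct κ (w e : ℝ) _ _ _ _ _ _ hκ (unitInterval.nonneg (w e)) (unitInterval.le_one (w e)) h0 h1 hmono

/-- **Form 2 at the percolation level** (condition on `F`): endpoint rows, `P₀F, P₁F > 0`, and
`(P₁(F∩E)·P₀F − P₀(F∩E)·P₁F)·(P₁F − P₀F) ≥ 0` (the conditional probability `P(E | F)` moves with `P(F)` along the pair) give the row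
under `w`. [this work] -/
theorem revHarris_of_pair_condF (κ : ℝ) (F E : Set (BondConfig (Fin n)))
    (w : Sym2 (Fin n) → unitInterval) (e : Sym2 (Fin n))
    (hF0 : 0 < (prodBernoulli (Function.update w e 0)).real F) (hF1 : 0 < (prodBernoulli (Function.update w e 1)).real F)
    (h0 : κ * (prodBernoulli (Function.update w e 0)).real F * (prodBernoulli (Function.update w e 0)).real E
        ≤ (prodBernoulli (Function.update w e 0)).real (F ∩ E))
    (h1 : κ * (prodBernoulli (Function.update w e 1)).real F * (prodBernoulli (Function.update w e 1)).real E
        ≤ (prodBernoulli (Function.update w e 1)).real (F ∩ E))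
    (hW : 0 ≤ ((prodBernoulli (Function.update w e 1)).real (F ∩ E) * (prodBernoulli (Function.update w e 0)).real F
          - (prodBernoulli (Function.update w e 0)).real (F ∩ E) * (prodBernoulli (Function.update w e 1)).real F) *
        ((prodBernoulli (Function.update w e 1)).real F - (prodBernoulli (Function.update w e 0)).real F)) :
    κ * (prodBernoulli w).real F * (prodBernoulli w).real E ≤ (prodBernoulli w).real (F ∩ E) := by
  rw [stub_oneBondDecomp_k15 n w e F, stub_oneBondDecomp_k15 n w e E, stub_oneBondDecomp_k15 n w e (F ∩ E)]
  exact algCondF κ (w e : ℝ) _ _ _ _ _ _ (unitInterval.nonneg (w e)) (unitInterval.le_one (w e)) hF0 hF1 h0 h1 hW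

/-- **Form 3 at the percolation level** (condition on `E`): endpoint rows, `P₀E, P₁E > 0`, and
`(P₁(F∩E)·P₀E − P₀(F∩E)·P₁E)·(P₁E − P₀E) ≥ 0` give the row under `w`. [this work] -/
theorem revHarris_of_pair_condE (κ : ℝ) (F E : Set (BondConfig (Fin n)))
    (w : Sym2 (Fin n) → unitInterval) (e : Sym2 (Fin n))
    (hE0 : 0 < (prodBernoulli (Function.update w e 0)).real E) (hE1 : 0 < (prodBernoulli (Function.update w e 1)).real E)
    (h0 : κ * (prodBernoulli (Function.update w e 0)).real F * (prodBernoulli (Function.update w e 0)).real E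
        ≤ (prodBernoulli (Function.update w e 0)).real (F ∩ E))
    (h1 : κ * (prodBernoulli (Function.update w e 1)).real F * (prodBernoulli (Function.update w e 1)).real E
        ≤ (prodBernoulli (Function.update w e 1)).real (F ∩ E))
    (hW : 0 ≤ ((prodBernoulli (Function.update w e 1)).real (F ∩ E) * (prodBernoulli (Function.update w e 0)).real E
          - (prodBernoulli (Function.update w e 0)).real (F ∩ E) * (prodBernoulli (Function.update w e 1)).real E) *
        ((prodBernoulli (Function.update w e 1)).real E - (prodBernoulli (Function.update w e 0)).real E)) :
    κ * (prodBernoulli w).real F * (prodBernoulli w).real E ≤ (prodBernoulli w).real (F ∩ E) := by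
  rw [stub_oneBondDecomp_k15 n w e F, stub_oneBondDecomp_k15 n w e E, stub_oneBondDecomp_k15 n w e (F ∩ E)]
  exact algCondE κ (w e : ℝ) _ _ _ _ _ _ (unitInterval.nonneg (w e)) (unitInterval.le_one (w e)) hE0 hE1 h0 h1 hW

/-- **Base case**: at a 0/1-valued weight `P_w` is a point mass, so `κ·P(F)·P(E) ≤ P(F∩E)` for every `κ ≤ 1` and all events. [this work] -/
theorem revHarris_of_zeroOne (κ : ℝ) (hκ1 : κ ≤ 1) (F E : Set (BondConfig (Fin n)))
    (w : Sym2 (Fin n) → unitInterval) (hw : ∀ e, w e = 0 ∨ w e = 1) :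
    κ * (prodBernoulli w).real F * (prodBernoulli w).real E ≤ (prodBernoulli w).real (F ∩ E) := by
  rw [real_eq_ite_of_zeroOne w hw F, real_eq_ite_of_zeroOne w hw E, real_eq_ite_of_zeroOne w hw (F ∩ E)]
  have hκF : ∀ x : ℝ, 0 ≤ x → x ≤ 1 → κ * x ≤ 1 := fun x hx hx1 => by nlinarith
  by_cases hF : {e | w e = 1} ∈ F
  · by_cases hE : {e | w e = 1} ∈ E
    · simp [hF, hE, Set.mem_inter_iff]; linarith
    · simp [hF, hE, Set.mem_inter_iff]
  · simp [hF, Set.mem_inter_iff]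

/-- **THE EDGE-INTERPOLATION SCHEMA.**  Fix events `F, E` and `0 ≤ κ ≤ 1`.  Suppose that at every weight `w` having a fractional pair, EITHER
the row `κ·P_w(F)·P_w(E) ≤ P_w(F∩E)` holds outright (base cases supplied by the user), OR some fractional pair `e` satisfies one of the three
interpolation criteria (form 1 / form 2 / form 3, with the positivity side conditions).  Then the row holds at every weight.
(Induction on the number of fractional pairs; 0/1-valued weights by `revHarris_of_zeroOne`.)  With `F = {s↔a} ∩ {s↮b}`, `E = {c↔s} ∪ {c↔b}`,
`κ = 2/3` and the glued configurations settled by (C½), the hypothesis is CONJECTURE E* of the lead memo. [this work] -/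
theorem revHarris_of_goodPairs (κ : ℝ) (hκ0 : 0 ≤ κ) (hκ1 : κ ≤ 1) (F E : Set (BondConfig (Fin n)))
    (hgood : ∀ w : Sym2 (Fin n) → unitInterval, (∃ e, w e ≠ 0 ∧ w e ≠ 1) →
      (κ * (prodBernoulli w).real F * (prodBernoulli w).real E ≤ (prodBernoulli w).real (F ∩ E)) ∨
      ∃ e, w e ≠ 0 ∧ w e ≠ 1 ∧
        ( (0 ≤ ((prodBernoulli (Function.update w e 1)).real F - (prodBernoulli (Function.update w e 0)).real F) *
              ((prodBernoulli (Function.update w e 1)).real E - (prodBernoulli (Function.update w e 0)).real E))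
        ∨ (0 < (prodBernoulli (Function.update w e 0)).real F ∧ 0 < (prodBernoulli (Function.update w e 1)).real F ∧
            0 ≤ ((prodBernoulli (Function.update w e 1)).real (F ∩ E) * (prodBernoulli (Function.update w e 0)).real F
                - (prodBernoulli (Function.update w e 0)).real (F ∩ E) * (prodBernoulli (Function.update w e 1)).real F) *
              ((prodBernoulli (Function.update w e 1)).real F - (prodBernoulli (Function.update w e 0)).real F))
        ∨ (0 < (prodBernoulli (Function.update w e 0)).real E ∧ 0 < (prodBernoulli (Function.update w e 1)).real E ∧
            0 ≤ ((prodBernoulli (Function.update w e 1)).real (F ∩ E) * (prodBernoulli (Function.update w e 0)).real E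
                - (prodBernoulli (Function.update w e 0)).real (F ∩ E) * (prodBernoulli (Function.update w e 1)).real E) *
              ((prodBernoulli (Function.update w e 1)).real E - (prodBernoulli (Function.update w e 0)).real E)) )) :
    ∀ w : Sym2 (Fin n) → unitInterval,
      κ * (prodBernoulli w).real F * (prodBernoulli w).real E ≤ (prodBernoulli w).real (F ∩ E) := by
  -- induction on the number of fractional pairs
  suffices H : ∀ (k : ℕ) (w : Sym2 (Fin n) → unitInterval), (fracEdges w).card ≤ k →
      κ * (prodBernoulli w).real F * (prodBernoulli w).real E ≤ (prodBernoulli w).real (F ∩ E) from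
    fun w => H _ w le_rfl
  intro k
  induction k with
  | zero =>
      intro w hk
      have hw : ∀ e, w e = 0 ∨ w e = 1 := fun e =>
        eq_zero_or_one_of_not_mem_fracEdges (by
          intro he
          have : 0 < (fracEdges w).card := Finset.card_pos.2 ⟨e, he⟩
          omega)
      exact revHarris_of_zeroOne κ hκ1 F E w hw
  | succ k ih =>
      intro w hk
      by_cases hempty : fracEdges w = ∅
      · have hw : ∀ e, w e = 0 ∨ w e = 1 := fun e => eq_zero_or_one_of_not_mem_fracEdges (by rw [hempty]; simp)
        exact revHarris_of_zeroOne κ hκ1 F E w hw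
      · obtain ⟨e0, he0⟩ := Finset.nonempty_iff_ne_empty.2 hempty
        have hfrac : ∃ e, w e ≠ 0 ∧ w e ≠ 1 := by
          refine ⟨e0, ?_, ?_⟩
          · intro h
            simp only [fracEdges, Finset.mem_filter, Finset.mem_univ, true_and] at he0
            rw [h] at he0; simp at he0
          · intro h
            simp only [fracEdges, Finset.mem_filter, Finset.mem_univ, true_and] at he0
            rw [h] at he0; simp at he0
        rcases hgood w hfrac with hrow | ⟨e, he0', he1', hcrit⟩
        · exact hrow
        · have he : e ∈ fracEdges w := by
            simp only [fracEdges, Finset.mem_filter, Finset.mem_univ, true_and]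
            have h0 : (0 : ℝ) ≤ w e := (w e).2.1
            have h1 : (w e : ℝ) ≤ 1 := (w e).2.2
            refine ⟨lt_of_le_of_ne h0 ?_, lt_of_le_of_ne h1 ?_⟩
            · intro h; apply he0'; exact Subtype.ext h.symm
            · intro h; apply he1'; exact Subtype.ext h
          have hcard0 : (fracEdges (Function.update w e 0)).card ≤ k := by
            have h1 := Finset.card_le_card (fracEdges_update_subset w e 0 (Or.inl rfl))
            rw [Finset.card_erase_of_mem he] at h1
            omega
          have hcard1 : (fracEdges (Function.update w e 1)).card ≤ k := by
            have h1 := Finset.card_le_card (fracEdges_update_subset w e 1 (Or.inr rfl))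
            rw [Finset.card_erase_of_mem he] at h1
            omega
          have ih0 := ih (Function.update w e 0) hcard0
          have ih1 := ih (Function.update w e 1) hcard1
          rcases hcrit with hc1 | ⟨hF0, hF1, hc2⟩ | ⟨hE0, hE1, hc3⟩
          · exact revHarris_of_pair_product κ hκ0 F E w e ih0 ih1 hc1
          · exact revHarris_of_pair_condF κ F E w e hF0 hF1 ih0 ih1 hc2
          · exact revHarris_of_pair_condE κ F E w e hE0 hE1 ih0 ih1 hc3

end IncStar

end Summit.CriticalPhenomena.PercolationContinuityZ3.Theorems
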